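import Summits.QuantumFields.BalabanUV.Beta.GAN24.ScaleNesting

/-!
# `BalabanUV.Beta.GAN24.DilationCovariance` — binder row G-an2-4 / (CONV-C), S-slot («E3Shape» ∧ «E3SupRate»): generic leaf «DILATE*»
# of `HOME/b2b-balaban-gan24-p1/SKELETON-S3.md` v1.0 §13.2 (c), part 2 — THE EXACT `Lc`-DILATION COVARIANCE OF an2's BORDER AND
# LAGRANGE INCREMENTS (`BalabanCompositeJets.borderInc` / `lagrInc`) and of their pushes

NOT IN PRINT; OUR BOOKKEEPING.  HONEST FRAMING (cell contract, verbatim): «discharging `BetaPertH` makes Bałaban's UV stability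
UNCONDITIONAL — a real constructive-QFT result; it is NOT the continuum limit and NOT the Clay problem.»  HONEST DEPENDENCY (verbatim):
«continuum YM on T⁴ ⇐ BetaPertH ∧ nine spine estimates (0/9 proved); BetaPertH ⇐ (D1) ∧ (D4) ∧ CAP+tail; G-an2-4 gates asym, D1 and
NE2/3/4.»  [folklore] identities over an2's DEFINITIONS `BalabanCompositeJets.borderInc` / `lagrInc` / `pushSum` / `bshift`,
`InterLevelTransport.avgLift` / `cwsum` / `SLam` / `onLat`, an4's `DecLiftAdjoint.borderSum` / `avgLift_wsum` — BY NAME, nothing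
redefined; NO estimate (the only «analysis» is absolute convergence of the coarse superposition inside `lagrInc`, from the tree's
`decays_KInv` + `abs_lamCoeffOf_le` + `biLoc_hessFF`, so that `lagrInc_mul` is UNCONDITIONAL), NO cited fact, NO `def … : Prop`, NO
`def` at all, NO wall binder, nothing asserted of Bałaban's objects.  Leaf «DILATE*» of unit `b2b-balaban-gan24-formalise-leaf-05`
(gen 18), opened to idle seats by the row owner (gan24-p1-g4, cell journal RULINGS-5: «the Lc-dilation covariance of `borderInc` /
`lagrInc` / `pushSum` (bookkeeping: `borderInc d Lc (M·Lc)` at `Lc•u` vs `borderInc d Lc M` at `u`, over `PushSumNest` §4 / `quo`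
arithmetic)»); the reserved family `GAN24.StencilSlotE3*` is untouched.  NOT summit progress; nothing of (CONV-C)'s S-slot is
discharged here; the analytic two-level inputs («(N1-Cauchy)», L1, the K-slot's `CauchyDecayK`) are NOT touched.

## What is proved (generic `d`, dilation factor `P ≠ 0`, any `M`; the S-slot instances take `P = Lc`, `M = Lc^{m+1}`)
* §1 BORDER.  **`borderSum_mul`** / **`borderInc_mul`**:
  `borderInc d Lc (P·M) κ u = Σ_{t<P} avgLift P (borderInc d Lc M κ ⌊(u − t e_κ)/P⌋)` — the level-`(P·M)` border increment at the fine
  bond `(κ, u)` IS the `P`-LIFT of the level-`M` border increments (objects of the `P`-times coarser lattice read as the fine one) at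
  the `P` bonds of the `P`-lattice whose straight `P`-contours pass through `(κ, u)`; mechanism `k = P·s + t` (`sum_range_mul'`),
  `⌊(u − k e_κ)/(PM)⌋ = ⌊(⌊(u − t e_κ)/P⌋ − s e_κ)/M⌋` (`quo_sub_bshift_mul_add`), `avgLift (P·M) = avgLift P ∘ avgLift M`
  (`ScaleNesting.avgLift_avgLift`).  PUSHED: **`pushSum_borderInc_mul`** (`ScaleNesting.pushSum_avgLift` + linearity), and the S-slot
  instances **`pushSum_borderInc_pow_succ`** (rows V/dV: `pushSum (Lc^{m+3}) L (borderInc d Lc (Lc^{m+2}) κ u) = Σ_{t<Lc} avgLift Lc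
  (pushSum (Lc^{m+2}) L (borderInc d Lc (Lc^{m+1}) κ ⌊(u − t e_κ)/Lc⌋))`), `borderInc_pow_succ` (rows Vt/dVt).  AT A DILATED BOND (the
  owner's literal phrasing «`borderInc d Lc (M·Lc)` at `Lc•u` vs `borderInc d Lc M` at `u`»): **`borderInc_mul_zsmul`**:
  `borderInc d Lc (P·M) κ (P•ū) = avgLift P (borderInc d Lc M κ ū) + (P − 1) · avgLift P (borderInc d Lc M κ (ū − e_κ))` — the own
  bond once and the PRECEDING bond `P − 1` times (`quo_zsmul_sub_bshift`): the dilated fine bond lies on the `P`-contours of both;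
  with the CELL OFFSET explicit (RULINGS-6), **`borderInc_mul_zsmul_add`**: at `(κ, P•ū + r)`, `r ∈ [0,P)^{d+1}`, the weights are
  `(r_κ + 1)` and `(P − 1 − r_κ)` (`quo_toSite_sub_bshift`) — EXACT entrywise, no ℓ¹-mass inequality needed.
* §2 LAGRANGE.  `avgLift_zero`, `avgLift_onLat`, **`avgLift_cwsum`**, **`avgLift_SLam`** (the lift commutes with coarse superpositions /
  the abstract multiplier-curvature stencil, for decaying coefficients and bounded tables — through an4's `avgLift_wsum`), and
  **`lagrInc_mul`**: `lagrInc d Lc (P·M) N′ κ u = avgLift P (SLam N′ (lamCoeffOf (KInv N′) N′) (avgLift M ∘ hessFF Lc) κ u)` — EXACT and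
  UNCONDITIONAL; S-slot instance **`pushSum_lagrInc_pow_succ`** (rows Λ/dL, Λt/dLt).  NOTE what is NOT claimed: the multiplier
  response of blocking `N′` stays that of `N′` — comparing `lamCoeffOf (KInv (Lc·N))` with `lamCoeffOf (KInv N)`, like comparing the
  normalised legs `H̃_{N·Lc}` with `H̃_N`, is the located analytic input «(N1-Cauchy)»/L1 of `SKELETON-S3.md` §13.2, not bookkeeping.
READING for the RATE rows (displayed, not claimed): with these identities member `n+3`'s depth-`k` piece is LITERALLY `avgLift Lc` of
member `n+2`'s depth-`k` geometric tables (plus the neighbouring-bond term at dilated bonds), so its third-jet sandwich through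
`KInv (Lc^{n+3})` is, by an4's `DecLiftAdjoint.vertexOfK_avgLift` / `hessKer_avgLift` (BY NAME), a sandwich of member `n+2`'s tables
through the DECIMATED legs `dec Lc (KInv (Lc^{n+3}))` — whose comparison with `KInv (Lc^{n+2})`'s normalised legs is exactly the
two-level input; nothing of that comparison is asserted here.
-/

noncomputable section

open Finset
open scoped BigOperators
open Literature.MathematicalPhysics.QuantumFieldTheory
open Literature.MathematicalPhysics.QuantumFieldTheory.Balaban1983to89
open Literature.MathematicalPhysics.QuantumFieldTheory.Balaban1983to89.Beta
open Literature.Probability.LatticeModels (Torus.proj)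
open LatticeForm (quo)
open BlochFibreUniqueness (quo_add_zsmul)
open B12Sec2to5 (l1)
open ExpKernelCalculus (MKer)
open AveragingHessianKernels (hessFF biLoc_hessFF ell)
open BalabanStepJets (lamCoeffOf abs_lamCoeffOf_le)
open OneStepResolventKernel (Fib quo_zsmul eq_zsmul_quo_of_proj wsum KInv decays_KInv)
open InterLevelTransport (avgLift onLat cwsum SLam)
open AffineAveraging (box toSite)
open BalabanCompositeJets (pushSum bshift borderInc lagrInc)
open DecLiftAdjoint (borderSum borderInc_eq_borderSum avgLift_finset_sum avgLift_smul avgLift_wsum abs_avgLift_le)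
open Summit.QuantumFields.BalabanUV.Beta.GAN24.PushSumNest (pushSum_finset_sum)
open Summit.QuantumFields.BalabanUV.Beta.GAN24.ScaleNesting (quo_mul avgLift_avgLift pushSum_avgLift pushSum_avgLift')

namespace Summit.QuantumFields.BalabanUV.Beta.GAN24.DilationCovariance

variable {d : ℕ}

/-! ## §1 The dilation covariance of the `M`-contour sum of a lifted stencil family (`borderSum`, `borderInc`) -/

section Border

/-- [folklore] Re-indexing `range (P·M)` by remainder and quotient: `k = P·s + t`, `t < P`, `s < M`. -/
theorem sum_range_mul' {E : Type*} [AddCommMonoid E] (P M : ℕ) (f : ℕ → E) :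
    ∑ k ∈ Finset.range (P * M), f k = ∑ t ∈ Finset.range P, ∑ s ∈ Finset.range M, f (P * s + t) := by
  induction M with
  | zero => simp only [mul_zero, Finset.range_zero, Finset.sum_empty, Finset.sum_const_zero]
  | succ M ih =>
      rw [Nat.mul_succ, Finset.sum_range_add, ih, ← Finset.sum_add_distrib]
      exact Finset.sum_congr rfl fun t _ => by rw [Finset.sum_range_succ]

/-- [folklore] `bshift κ (P·s + t) = P • bshift κ s + bshift κ t`. -/
theorem bshift_mul_add (κ : Fin (d + 1)) (P s t : ℕ) :
    bshift d κ (P * s + t) = (P : ℤ) • bshift d κ s + bshift d κ t := by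
  funext j
  simp only [bshift, Pi.add_apply, Pi.smul_apply, smul_eq_mul]
  split_ifs
  · push_cast; ring
  · simp

/-- [folklore] The `P`-block index of `u − (P·s + t)e_κ` is that of `u − t e_κ` moved back by `s e_κ`. -/
theorem quo_sub_bshift_mul_add (P : ℕ) [NeZero P] (κ : Fin (d + 1)) (u : Fin (d + 1) → ℤ) (s t : ℕ) :
    quo P (u - bshift d κ (P * s + t)) = quo P (u - bshift d κ t) - bshift d κ s := by
  rw [bshift_mul_add, show u - ((P : ℤ) • bshift d κ s + bshift d κ t) = (u - bshift d κ t) + (P : ℤ) • (-bshift d κ s) by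
    rw [smul_neg]; abel, quo_add_zsmul, ← sub_eq_add_neg]

/-- [folklore] **THE DILATION COVARIANCE OF THE CONTOUR-SUMMED LIFT** (generic form).  For a level-independent coarse stencil
family `G`, the `(P·M)`-contour sum of its `(P·M)`-lift at the fine bond `(κ, u)` is the `P`-LIFT of the `M`-contour sums of its
`M`-lifts (objects of the `P`-times coarser lattice, read there as the fine lattice) at the `P` bonds `(κ, ⌊(u − t e_κ)/P⌋)`,
`t < P`, of the `P`-lattice whose straight `P`-contours pass through `(κ, u)`:
`borderSum (P·M) G κ u = Σ_{t<P} avgLift P (borderSum M G κ ⌊(u − t e_κ)/P⌋)`.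
Mechanism: `k = P·s + t` (`sum_range_mul'`), `⌊(u − k e_κ)/(PM)⌋ = ⌊(⌊(u − t e_κ)/P⌋ − s e_κ)/M⌋` (`quo_mul`,
`quo_sub_bshift_mul_add`), and `avgLift (P·M) = avgLift P ∘ avgLift M` (`avgLift_avgLift`). -/
theorem borderSum_mul (P M : ℕ) [NeZero P] (G : Fin (d + 1) → (Fin (d + 1) → ℤ) → MKer (d + 1) (Fib d))
    (κ : Fin (d + 1)) (u : Fin (d + 1) → ℤ) :
    borderSum (P * M) G κ u =
      fun x w a b => ∑ t ∈ Finset.range P, avgLift P (borderSum M G κ (quo P (u - bshift d κ t))) x w a b := by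
  funext x w a b
  have e : ∀ t : ℕ, avgLift P (borderSum M G κ (quo P (u - bshift d κ t))) x w a b =
      ∑ s ∈ Finset.range M, avgLift P (avgLift M (G κ (quo M (quo P (u - bshift d κ t) - bshift d κ s)))) x w a b := by
    intro t
    have h := avgLift_finset_sum (Finset.range M) P (fun s => avgLift M (G κ (quo M (quo P (u - bshift d κ t) - bshift d κ s))))
    exact congrFun (congrFun (congrFun (congrFun h x) w) a) b
  simp only [e, borderSum]
  rw [sum_range_mul' P M]
  refine Finset.sum_congr rfl fun t _ => Finset.sum_congr rfl fun s _ => ?_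
  rw [avgLift_avgLift, quo_mul, quo_sub_bshift_mul_add]

/-- [folklore] **THE DILATION COVARIANCE OF an2's BORDER INCREMENT** (`BalabanCompositeJets.borderInc`, the instance
`G κ z := mfNeg (vhS d Lc κ z)` of `borderSum` — `DecLiftAdjoint.borderInc_eq_borderSum`): the border increment at the passage
`P·M → P·M·Lc` is the `P`-lift of the border increments at the passage `M → M·Lc` taken at the `P` bonds of the `P`-lattice through
the fine bond.  (`Lc` = the one-step blocking inside an1's table `vhS d Lc`; `P` = the dilation factor; they are independent here —
the S-slot's RATE rows use `P = Lc`, `M = Lc^{m+1}`.) -/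
theorem borderInc_mul (Lc P M : ℕ) [NeZero P] (κ : Fin (d + 1)) (u : Fin (d + 1) → ℤ) :
    borderInc d Lc (P * M) κ u =
      fun x w a b => ∑ t ∈ Finset.range P, avgLift P (borderInc d Lc M κ (quo P (u - bshift d κ t))) x w a b := by
  rw [borderInc_eq_borderSum]
  exact borderSum_mul P M _ κ u

/-- [folklore] **DILATION COVARIANCE OF A PUSHED BORDER INCREMENT**: pushing (factor `L`, from scale `P·M′`) the level-`(P·M)` border
increment IS the `P`-lift of the pushes (factor `L`, from scale `M′`) of the level-`M` border increments at the `P` bonds through the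
fine bond (`borderInc_mul` + `pushSum_avgLift` + linearity of the push). -/
theorem pushSum_borderInc_mul (Lc P M M' L : ℕ) [NeZero P] (κ : Fin (d + 1)) (u : Fin (d + 1) → ℤ) :
    pushSum (P * M') L (borderInc d Lc (P * M) κ u) =
      fun x w a b => ∑ t ∈ Finset.range P,
        avgLift P (pushSum M' L (borderInc d Lc M κ (quo P (u - bshift d κ t)))) x w a b := by
  have e : borderInc d Lc (P * M) κ u =
      ∑ t ∈ Finset.range P, avgLift P (borderInc d Lc M κ (quo P (u - bshift d κ t))) := by
    rw [borderInc_mul]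
    funext x w a b
    simp only [Finset.sum_apply]
  rw [e, pushSum_finset_sum]
  funext x w a b
  simp only [Finset.sum_apply, pushSum_avgLift]

/-- [folklore] **THE S-SLOT INSTANCE** (row V of the SHAPE table / rows dV of the RATE table of `SKELETON-S3.md` §12–§13, by depth
pairing): member `n+3`'s level-`(m+2)` border piece, pushed `L` more times from its own lattice `Lc^{m+3}•ℤ^{d+1}`, is the `Lc`-LIFT of
member `n+2`'s level-`(m+1)` border pieces (pushed `L` times from `Lc^{m+2}•ℤ^{d+1}`) at the `Lc` bonds of the `Lc`-lattice through the
fine bond — the same geometric tables one lattice scale up: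
`pushSum (Lc^{m+3}) L (borderInc d Lc (Lc^{m+2}) κ u) = Σ_{t<Lc} avgLift Lc (pushSum (Lc^{m+2}) L (borderInc d Lc (Lc^{m+1}) κ ⌊(u − t e_κ)/Lc⌋))`.
(Scalar weights `cVH·(Lc^{m+2})^{d+2}` vs `cVH·(Lc^{m+1})^{d+2}` and the normalised legs of blockings `Lc^{n+3}` vs `Lc^{n+2}` are the
RATE-row prover's; this is the exact bookkeeping half.) -/
theorem pushSum_borderInc_pow_succ (Lc : ℕ) [NeZero Lc] (m L : ℕ) (κ : Fin (d + 1)) (u : Fin (d + 1) → ℤ) :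
    pushSum (Lc ^ (m + 3)) L (borderInc d Lc (Lc ^ (m + 2)) κ u) =
      fun x w a b => ∑ t ∈ Finset.range Lc,
        avgLift Lc (pushSum (Lc ^ (m + 2)) L (borderInc d Lc (Lc ^ (m + 1)) κ (quo Lc (u - bshift d κ t)))) x w a b := by
  rw [show Lc ^ (m + 3) = Lc * Lc ^ (m + 2) from pow_succ' Lc (m + 2),
    show Lc ^ (m + 2) = Lc * Lc ^ (m + 1) from pow_succ' Lc (m + 1)]
  exact pushSum_borderInc_mul Lc Lc (Lc ^ (m + 1)) (Lc * Lc ^ (m + 1)) L κ u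

/-- [folklore] The unpushed (top-level) instance: `borderInc d Lc (Lc^{m+2}) κ u = Σ_{t<Lc} avgLift Lc (borderInc d Lc (Lc^{m+1}) κ ⌊(u − t e_κ)/Lc⌋)`
(rows Vt / dVt). -/
theorem borderInc_pow_succ (Lc : ℕ) [NeZero Lc] (m : ℕ) (κ : Fin (d + 1)) (u : Fin (d + 1) → ℤ) :
    borderInc d Lc (Lc ^ (m + 2)) κ u =
      fun x w a b => ∑ t ∈ Finset.range Lc, avgLift Lc (borderInc d Lc (Lc ^ (m + 1)) κ (quo Lc (u - bshift d κ t))) x w a b := by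
  rw [show Lc ^ (m + 2) = Lc * Lc ^ (m + 1) from pow_succ' Lc (m + 1)]
  exact borderInc_mul Lc Lc (Lc ^ (m + 1)) κ u

/-- [folklore] The `P`-block index of `P•ū − t e_κ` for `1 ≤ t ≤ P` is the PRECEDING bond `ū − e_κ` (`⌊−t/P⌋ = −1`). -/
theorem quo_zsmul_sub_bshift (P : ℕ) [NeZero P] (κ : Fin (d + 1)) (ū : Fin (d + 1) → ℤ) {t : ℕ} (ht1 : 1 ≤ t)
    (htP : t ≤ P) : quo P ((P : ℤ) • ū - bshift d κ t) = ū - bshift d κ 1 := by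
  have hP : (0 : ℤ) < P := by exact_mod_cast Nat.pos_of_ne_zero (NeZero.ne P)
  rw [show (P : ℤ) • ū - bshift d κ t = -bshift d κ t + (P : ℤ) • ū by abel, quo_add_zsmul,
    show ū - bshift d κ 1 = -bshift d κ 1 + ū by abel]
  congr 1
  funext j
  simp only [quo, bshift, Pi.neg_apply]
  split_ifs with hj
  · have h := ((Int.ediv_emod_unique (a := -(t : ℤ)) (r := (P : ℤ) - t) (q := -1) hP).2
      ⟨by ring, by omega, by omega⟩).1
    rw [h]
    simp
  · simp

/-- [folklore] The `P`-block index of `P•ū − 0·e_κ` is `ū`. -/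
theorem quo_zsmul_sub_bshift_zero (P : ℕ) [NeZero P] (κ : Fin (d + 1)) (ū : Fin (d + 1) → ℤ) :
    quo P ((P : ℤ) • ū - bshift d κ 0) = ū := by
  have h0 : bshift d κ 0 = 0 := by
    funext j
    simp [bshift]
  rw [h0, sub_zero, quo_zsmul]

/-- [folklore] **THE BORDER INCREMENT AT A DILATED BOND** (the owner's literal phrasing «`borderInc d Lc (M·Lc)` at `Lc•u` vs
`borderInc d Lc M` at `u`», generic dilation factor `P`): the level-`(P·M)` border increment at the dilated fine bond `(κ, P•ū)` is the
`P`-lift of the level-`M` border increment at `(κ, ū)` PLUS `(P − 1)` times the `P`-lift of the one at the preceding bond `(κ, ū − e_κ)`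
— the dilated bond lies on the straight `P`-contour of its own `P`-block once (`t = 0`) and on those of the preceding block `P − 1` times
(`1 ≤ t < P`).  No single-term covariance holds at the fine level; this is the exact statement. -/
theorem borderInc_mul_zsmul (Lc P M : ℕ) [NeZero P] (κ : Fin (d + 1)) (ū : Fin (d + 1) → ℤ) :
    borderInc d Lc (P * M) κ ((P : ℤ) • ū) = fun x w a b =>
      avgLift P (borderInc d Lc M κ ū) x w a b +
        ((P - 1 : ℕ) : ℝ) * avgLift P (borderInc d Lc M κ (ū - bshift d κ 1)) x w a b := by
  rw [borderInc_mul]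
  funext x w a b
  have hP : 0 < P := Nat.pos_of_ne_zero (NeZero.ne P)
  rw [Finset.range_eq_Ico, Finset.sum_eq_sum_Ico_succ_bot hP, quo_zsmul_sub_bshift_zero]
  congr 1
  rw [Finset.sum_congr rfl fun t ht =>
      (by rw [quo_zsmul_sub_bshift P κ ū (Finset.mem_Ico.1 ht).1 (Finset.mem_Ico.1 ht).2.le] :
        avgLift P (borderInc d Lc M κ (quo P ((P : ℤ) • ū - bshift d κ t))) x w a b =
          avgLift P (borderInc d Lc M κ (ū - bshift d κ 1)) x w a b),
    Finset.sum_const, Nat.card_Ico, zero_add, nsmul_eq_mul]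

/-- [folklore] The `P`-block index of `r − t e_κ` for a cell offset `r ∈ [0,P)^{d+1}` and a contour step `t < P`: `0` if `t ≤ r_κ`,
the preceding bond `−e_κ` otherwise. -/
theorem quo_toSite_sub_bshift (P : ℕ) [NeZero P] (κ : Fin (d + 1)) {r : Fin (d + 1) → ℕ} (hr : r ∈ box (d + 1) P)
    {t : ℕ} (ht : t < P) : quo P (toSite r - bshift d κ t) = if t ≤ r κ then 0 else -bshift d κ 1 := by
  have hr' : ∀ j, r j < P := fun j => by
    have h := Fintype.mem_piFinset.1 hr j
    simpa using h
  funext j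
  by_cases hj : j = κ
  · subst hj
    have hrj := hr' j
    split_ifs with hle
    · simp only [quo, toSite, bshift, Pi.sub_apply, if_true, Pi.zero_apply]
      exact Int.ediv_eq_zero_of_lt (by omega) (by omega)
    · simp only [quo, toSite, bshift, Pi.sub_apply, if_true, Pi.neg_apply, Nat.cast_one]
      exact Int.ediv_eq_neg_one_of_neg_of_le (by omega) (by omega)
  · have hrj := hr' j
    have h2 : (if j = κ then (t : ℤ) else 0) = 0 := if_neg hj
    have h3 : (if j = κ then ((1 : ℕ) : ℤ) else 0) = 0 := if_neg hj
    have hq : ((r j : ℤ) - 0) / (P : ℤ) = 0 := by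
      rw [sub_zero]
      exact Int.ediv_eq_zero_of_lt (by omega) (by omega)
    split_ifs
    · simpa only [quo, toSite, bshift, Pi.sub_apply, Pi.zero_apply, h2] using hq
    · simp only [quo, toSite, bshift, Pi.sub_apply, Pi.neg_apply, h2, h3, neg_zero]
      exact hq

/-- [folklore] **THE BORDER INCREMENT ON A DILATED CELL, CELL OFFSETS EXPLICIT** (owner RULINGS-6: «the EXACT relation between the
level-`(M·Lc)` object at fine arguments `Lc•u (+ r)` and the level-`M` object at `u` … with the cell offsets `r ∈ [0,Lc)^{d+1}`
explicit»; generic dilation factor `P`): at the fine bond `(κ, P•ū + r)`, `r ∈ [0,P)^{d+1}`, the level-`(P·M)` border increment is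
`(r_κ + 1)` times the `P`-lift of the level-`M` border increment at `(κ, ū)` plus `(P − 1 − r_κ)` times the `P`-lift of the one at the
preceding bond `(κ, ū − e_κ)` — EXACT, as kernels in the four leg arguments (the `P`-lift `avgLift P` is itself the explicit
leg-offset sum of `InterLevelTransport.avgLift`: weight `P^{−(d+2)}` per field-leg contour index, multiplier legs read at `P•z`).
Only the `κ`-component of the offset matters; `r = 0` is `borderInc_mul_zsmul`. -/
theorem borderInc_mul_zsmul_add (Lc P M : ℕ) [NeZero P] (κ : Fin (d + 1)) (ū : Fin (d + 1) → ℤ) {r : Fin (d + 1) → ℕ}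
    (hr : r ∈ box (d + 1) P) :
    borderInc d Lc (P * M) κ ((P : ℤ) • ū + toSite r) = fun x w a b =>
      ((r κ + 1 : ℕ) : ℝ) * avgLift P (borderInc d Lc M κ ū) x w a b +
        ((P - (r κ + 1) : ℕ) : ℝ) * avgLift P (borderInc d Lc M κ (ū - bshift d κ 1)) x w a b := by
  have hrκ : r κ < P := by
    have h := Fintype.mem_piFinset.1 hr κ
    simpa using h
  rw [borderInc_mul]
  funext x w a b
  have e : ∀ t ∈ Finset.range P,
      quo P ((P : ℤ) • ū + toSite r - bshift d κ t) = if t ≤ r κ then ū else ū - bshift d κ 1 := by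
    intro t ht
    rw [show (P : ℤ) • ū + toSite r - bshift d κ t = (toSite r - bshift d κ t) + (P : ℤ) • ū by abel, quo_add_zsmul,
      quo_toSite_sub_bshift P κ hr (Finset.mem_range.1 ht)]
    split_ifs
    · rw [zero_add]
    · rw [neg_add_eq_sub]
  rw [Finset.sum_congr rfl fun t ht => by rw [e t ht], Finset.range_eq_Ico,
    ← Finset.sum_Ico_consecutive _ (Nat.zero_le (r κ + 1)) (by omega : r κ + 1 ≤ P)]
  congr 1
  · rw [Finset.sum_congr rfl fun t ht => by rw [if_pos (Nat.lt_succ_iff.1 (Finset.mem_Ico.1 ht).2)], Finset.sum_const,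
      Nat.card_Ico, Nat.sub_zero, nsmul_eq_mul]
  · rw [Finset.sum_congr rfl fun t ht => by rw [if_neg (by have h := (Finset.mem_Ico.1 ht).1; omega)], Finset.sum_const,
      Nat.card_Ico, nsmul_eq_mul]

end Border

/-! ## §2 The lift commutes with coarse superpositions (`cwsum`, `SLam`); the dilation covariance of the Lagrange increment -/

section Lagrange

/-- [folklore] The lift of the zero kernel vanishes. -/
theorem avgLift_zero (P : ℕ) : avgLift P (0 : MKer (d + 1) (Fib d)) = 0 := by
  funext x w a b
  simp [avgLift]

/-- [folklore] The lift commutes with extension by zero from the coarse sublattice (as families). -/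
theorem avgLift_onLat (P N : ℕ) (Q : (Fin (d + 1) → ℤ) → MKer (d + 1) (Fib d)) :
    (fun z => avgLift P (onLat N Q z)) = onLat N (fun y => avgLift P (Q y)) := by
  funext z
  by_cases h : Torus.proj N z = 0
  · simp only [onLat, h, if_true]
  · simp only [onLat, h, if_false, avgLift_zero]

/-- [folklore] **THE LIFT COMMUTES WITH COARSE-INDEXED SUPERPOSITIONS** `cwsum N w Q = Σ_y w y • Q y` for a weight decaying (fine
units) from a point and a bounded family (absolute convergence through `DecLiftAdjoint.avgLift_wsum`). -/
theorem avgLift_cwsum (P N : ℕ) [NeZero P] [NeZero N] {w : (Fin (d + 1) → ℤ) → ℝ} {C δ : ℝ} {p : Fin (d + 1) → ℤ}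
    (hw : ∀ y, |w y| ≤ C * Real.exp (-δ * l1 ((N : ℤ) • y - p))) (hδ : 0 < δ)
    {Q : (Fin (d + 1) → ℤ) → MKer (d + 1) (Fib d)} {CQ : ℝ} (hQ : ∀ y x z a b, |Q y x z a b| ≤ CQ) :
    avgLift P (cwsum N w Q) = cwsum N w (fun y => avgLift P (Q y)) := by
  have hC : 0 ≤ C := by
    have h := (abs_nonneg _).trans (hw 0)
    by_contra hC'
    have h' := mul_neg_of_neg_of_pos (not_le.mp hC') (Real.exp_pos (-δ * l1 ((N : ℤ) • (0 : Fin (d + 1) → ℤ) - p)))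
    linarith
  have hCQ : 0 ≤ CQ := (abs_nonneg _).trans (hQ 0 0 0 (Sum.inl 0) (Sum.inl 0))
  have hw' : ∀ v, |onLat N w v| ≤ C * Real.exp (-δ * l1 (v - p)) := by
    intro v
    by_cases h : Torus.proj N v = 0
    · simp only [onLat, h, if_true]
      have e := eq_zsmul_quo_of_proj (N := N) h
      have h1 := hw (quo N v)
      rw [← e] at h1
      exact h1
    · simp only [onLat, h, if_false, abs_zero]
      exact mul_nonneg hC (Real.exp_pos _).le
  have hQ' : ∀ z x z' a b, |onLat N Q z x z' a b| ≤ CQ := by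
    intro z x z' a b
    by_cases h : Torus.proj N z = 0
    · simp only [onLat, h, if_true]; exact hQ _ _ _ _ _
    · simp only [onLat, h, if_false, Pi.zero_apply, abs_zero]; exact hCQ
  unfold cwsum
  rw [avgLift_wsum P hw' hδ hQ', avgLift_onLat]

/-- [folklore] **THE LIFT COMMUTES WITH THE ABSTRACT MULTIPLIER-CURVATURE STENCIL** `InterLevelTransport.SLam`: for conversion
coefficients decaying from the perturbed fine bond and bounded curvature tables,
`avgLift P (SLam N c Q2 κ′ u) = SLam N c (avgLift P ∘ Q2) κ′ u`. -/
theorem avgLift_SLam (P N : ℕ) [NeZero P] [NeZero N]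
    {c : Fin (d + 1) → (Fin (d + 1) → ℤ) → Fin (d + 1) → (Fin (d + 1) → ℤ) → ℝ} {C δ : ℝ}
    (hc : ∀ μ y κ' u, |c μ y κ' u| ≤ C * Real.exp (-δ * l1 ((N : ℤ) • y - u))) (hδ : 0 < δ)
    {Q2 : Fin (d + 1) → (Fin (d + 1) → ℤ) → MKer (d + 1) (Fib d)} {CQ : ℝ} (hQ : ∀ μ y x z a b, |Q2 μ y x z a b| ≤ CQ)
    (κ' : Fin (d + 1)) (u : Fin (d + 1) → ℤ) :
    avgLift P (SLam N c Q2 κ' u) = SLam N c (fun μ y => avgLift P (Q2 μ y)) κ' u := by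
  have e : ∀ Q : Fin (d + 1) → (Fin (d + 1) → ℤ) → MKer (d + 1) (Fib d), SLam N c Q κ' u =
      (-1 : ℝ) • (fun x z a b => ∑ μ : Fin (d + 1), cwsum N (fun y => c μ y κ' u) (Q μ) x z a b) := by
    intro Q
    funext x z a b
    simp only [SLam, Pi.smul_apply, smul_eq_mul, neg_one_mul]
  rw [e, e, avgLift_smul, avgLift_finset_sum]
  congr 1
  funext x z a b
  refine Finset.sum_congr rfl fun μ _ => ?_
  rw [avgLift_cwsum P N (fun y => hc μ y κ' u) hδ (fun y => hQ μ y)]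

/-- [folklore] **THE DILATION COVARIANCE OF an2's LAGRANGE INCREMENT** (`BalabanCompositeJets.lagrInc`): the Lagrange increment
whose curvature tables are lifted by `P·M` IS the `P`-lift of the abstract multiplier-curvature stencil built from the SAME
level-`N′` multiplier response `lamCoeffOf (KInv N′) N′` and the `M`-lifted tables:
`lagrInc d Lc (P·M) N′ κ u = avgLift P (SLam N′ (lamCoeffOf (KInv N′) N′) (avgLift M ∘ hessFF Lc) κ u)` — exact and unconditional
(absolute convergence from `decays_KInv`, `abs_lamCoeffOf_le`, `biLoc_hessFF`, all BY NAME).  NOTE what is NOT claimed: the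
response of blocking `N′` is not that of a coarser blocking — comparing `lamCoeffOf (KInv (Lc·N))` with `lamCoeffOf (KInv N)` is the
analytic two-level input («(N1-Cauchy)»/L1 of `SKELETON-S3.md` §13.2), not bookkeeping. -/
theorem lagrInc_mul {Lc : ℕ} (hLc : 1 ≤ Lc) (P M N' : ℕ) [NeZero P] [NeZero M] [NeZero N'] (κ : Fin (d + 1))
    (u : Fin (d + 1) → ℤ) :
    lagrInc d Lc (P * M) N' κ u =
      avgLift P (SLam N' (lamCoeffOf (KInv (N := N') (d := d)) N') (fun μ y => avgLift M (hessFF Lc μ y)) κ u) := by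
  obtain ⟨δ₀, C₀, hδ₀, hC₀, hdec⟩ := decays_KInv (N := N') (d := d)
  have hc := abs_lamCoeffOf_le (N := N') hdec hC₀ hδ₀.le
  have hQ : ∀ (μ : Fin (d + 1)) (y x z : Fin (d + 1) → ℤ) (a b : Fib d),
      |avgLift M (hessFF (d := d) Lc μ y) x z a b| ≤ 2 * (ell (d + 1) Lc : ℝ) ^ 2 := by
    intro μ y x z a b
    refine abs_avgLift_le M (fun x' w' a' b' => ?_) x z a b
    have h := biLoc_hessFF hLc μ y le_rfl x' w' a' b'
    simp only [mul_zero, neg_zero, zero_mul, Real.exp_zero, mul_one] at h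
    exact h
  unfold lagrInc
  rw [avgLift_SLam P N' hc hδ₀ hQ]
  simp only [avgLift_avgLift]

/-- [folklore] The same with the scale product supplied as an equation (the form used under powers of `Lc`). -/
theorem lagrInc_mul' {Lc : ℕ} (hLc : 1 ≤ Lc) {P M R : ℕ} [NeZero P] [NeZero M] (hR : R = P * M) (N' : ℕ) [NeZero N']
    (κ : Fin (d + 1)) (u : Fin (d + 1) → ℤ) :
    lagrInc d Lc R N' κ u =
      avgLift P (SLam N' (lamCoeffOf (KInv (N := N') (d := d)) N') (fun μ y => avgLift M (hessFF Lc μ y)) κ u) := by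
  subst hR; exact lagrInc_mul hLc P M N' κ u

/-- [folklore] **THE S-SLOT INSTANCE** (rows Λ / dL by depth pairing; Λt / dLt at the top): member `n+3`'s level-`(m+2)` Lagrange piece,
pushed `L` more times, is the `Lc`-LIFT of the push of the abstract multiplier-curvature stencil with member `n+3`'s level-`(m+3)`
multiplier response and member `n+2`'s level-`(m+1)` lifted tables:
`pushSum (Lc^{m+3}) L (lagrInc d Lc (Lc^{m+2}) (Lc^{m+3}) κ u)
   = avgLift Lc (pushSum (Lc^{m+2}) L (SLam (Lc^{m+3}) (lamCoeffOf (KInv (Lc^{m+3})) (Lc^{m+3})) (avgLift (Lc^{m+1}) ∘ hessFF Lc) κ u))`. -/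
theorem pushSum_lagrInc_pow_succ {Lc : ℕ} [NeZero Lc] (hLc : 1 ≤ Lc) (m L : ℕ) (κ : Fin (d + 1)) (u : Fin (d + 1) → ℤ) :
    pushSum (Lc ^ (m + 3)) L (lagrInc d Lc (Lc ^ (m + 2)) (Lc ^ (m + 3)) κ u) =
      avgLift Lc (pushSum (Lc ^ (m + 2)) L
        (SLam (Lc ^ (m + 3)) (lamCoeffOf (KInv (N := Lc ^ (m + 3)) (d := d)) (Lc ^ (m + 3)))
          (fun μ y => avgLift (Lc ^ (m + 1)) (hessFF Lc μ y)) κ u)) := by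
  rw [lagrInc_mul' hLc (show Lc ^ (m + 2) = Lc * Lc ^ (m + 1) from pow_succ' Lc (m + 1)),
    pushSum_avgLift' Lc (Lc ^ (m + 2)) L (show Lc ^ (m + 3) = Lc * Lc ^ (m + 2) from pow_succ' Lc (m + 2))]

end Lagrange

end Summit.QuantumFields.BalabanUV.Beta.GAN24.DilationCovariance

end
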